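import Literature.NumberTheory.LFunctions.WeilExplicitRightEdge
import Literature.NumberTheory.LFunctions.WeilZeroSum
import Literature.Analysis.Complex.WeightedArgumentPrinciple
import HarnessLib

/-!
# Proof of the Guinand–Weil explicit formula (`Literature.NumberTheory.LFunctions.explicit_formula`)

DISCHARGE of the named fact `Literature.NumberTheory.LFunctions.explicit_formula` (`Literature/NumberTheory/LFunctions/WeilExplicit.lean`):
for every smooth compactly supported `g`,
`lim_{T→∞} Σ_{|Im ρ| ≤ T} m(ρ) ĝ(ρ) = ĝ(0) + ĝ(1) − Σ Λ(n) n^{-1/2}(g(log n) + g(−log n)) + W_∞(g)`.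

The proof is the contour-integral argument of E. Bombieri, *Remarks on Weil's quadratic functional
in the theory of prime numbers I*, Rend. Lincei (9) 11 (2000), §2 (there for `f(x) = x^{-1/2}g(log x)`,
`f̃ = ĝ`), organised as follows.

* `weilZeroSidePartial_eq_contour` — the residue theorem with weight (the tree's
  `Literature.Analysis.Complex.integral_boundary_rect_logDeriv_mul`) for `ξ` and `ĝ` on `[−1/2, 3/2] × [−T, T]`,
  `T` not an ordinate of a zero: the poles of `(ξ'/ξ)ĝ` are the non-trivial zeros, with residues
  `m(ρ)ĝ(ρ)` (`untop₀_meromorphicOrderAt_riemannXi`), and the left edge is folded onto the right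
  one by `ξ'/ξ(1−s) = −ξ'/ξ(s)`, the weight becoming `k̂ = ĝ + ĝ(1−·)` (`weilSymm`):
  `2πi Σ_{|Im ρ| ≤ T} m(ρ)ĝ(ρ) = (bottom) − (top) + i ∫_{−T}^{T} (ξ'/ξ)(3/2+iy) k̂(3/2+iy) dy`.
* `exists_goodHeight` — in every `[N, N+1]` there is a height `T` at distance `≥ η_N` from all
  ordinates of zeros, with `1/η_N = O(N⁴)` (from `Σ_ρ m(ρ)/(1+γ²)² < ∞`, `weilZeroSummable`; any
  polynomial bound suffices here because `ĝ` decays faster than any power on vertical strips,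
  `norm_weilMellin_le_cube`), so that by `exists_norm_logDeriv_riemannXi_le`
  (`|ξ'/ξ| ≤ C log T/η` on the horizontal sides) the horizontal sides tend to `0`
  (`tendsto_horizontal`).
* The right edge tends to `∫_ℝ (ξ'/ξ)(3/2+iy) k̂(3/2+iy) dy = 2π W(g)`
  (`integral_logDeriv_riemannXi_mul_weilMellin_weilSymm`, `WeilExplicitRightEdge.lean`: Mellin
  inversion for the prime and polar terms, the line shift of the Gamma term to `Re s = 1/2`).
* The truncated zero sums converge (absolutely, `hasWeilZeroSide_tsum`), hence their limit is
  `W(g)`: `explicit_formula_holds`.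

## References

* E. Bombieri, *Remarks on Weil's quadratic functional in the theory of prime numbers I*, Rend.
  Mat. Acc. Lincei (9) 11 (2000), 183–233, §2, Theorem 2.
* A. Weil, *Sur les "formules explicites" de la théorie des nombres premiers*, Comm. Sém. Math.
  Univ. Lund (1952), 252–265.
* H. Iwaniec, E. Kowalski, *Analytic Number Theory*, AMS Coll. Publ. 53 (2004), Thm. 5.12.
-/

noncomputable section

open Complex Filter Set MeasureTheory
open scoped Real Topology ComplexConjugate

namespace Literature.NumberTheory.LFunctions

variable {g : ℝ → ℂ}

/-! ### Zeros with positive real part -/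

/-- A zero of `ξ` is a non-trivial zero of `ζ`. [folklore] -/
theorem mem_riemannZetaNontrivialZeros_of_riemannXi_eq_zero {ρ : ℂ} (h : riemannXi ρ = 0) :
    ρ ∈ ZetaZeros.riemannZetaNontrivialZeros :=
  let ⟨hζ, h0, _, _⟩ := riemannXi_zero_prop h
  ZetaZeros.riemannZetaNontrivialZeros.mem_of_re_pos hζ h0

/-- `ξ(ρ) = 0` at every non-trivial zero `ρ` of `ζ`. [folklore] -/
theorem riemannXi_eq_zero_of_mem_riemannZetaNontrivialZeros {ρ : ℂ}
    (h : ρ ∈ ZetaZeros.riemannZetaNontrivialZeros) : riemannXi ρ = 0 :=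
  (riemannXi_eq_zero_iff_holds ρ).2 (ZetaZeros.riemannZetaNontrivialZeros.mem_iff'.1 h)

/-! ### A crude count of the zeros up to height `R` -/

/-- The total mass `Σ_ρ m(ρ)/(1+γ²)²` of the zeros (finite by `weilZeroSummable`) is `≥ 0`.
[folklore] -/
theorem tsum_weilZeroWeight_nonneg : 0 ≤ ∑' ρ : ZetaZeros.riemannZetaNontrivialZeros, weilZeroWeight (ρ : ℂ) :=
  tsum_nonneg fun ρ ↦ weilZeroWeight_nonneg ρ.2

/-- **Crude zero count**: the number of non-trivial zeros with `|Im ρ| ≤ R` is at most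
`(Σ_ρ m(ρ)/(1+γ²)²) · (1 + R²)²` (each such zero contributes `≥ (1+R²)⁻²` to the mass). [folklore] -/
theorem card_weilZeroFinset_le (R : ℝ) :
    ((weilZeroFinset R).card : ℝ) ≤ (∑' ρ : ZetaZeros.riemannZetaNontrivialZeros, weilZeroWeight (ρ : ℂ)) * (1 + R ^ 2) ^ 2 := by
  have hR : 0 < (1 + R ^ 2) ^ 2 := by positivity
  have hle : ∀ ρ ∈ weilZeroFinset R, ((1 + R ^ 2) ^ 2)⁻¹ ≤ weilZeroWeight (ρ : ℂ) := by
    intro ρ hρ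
    rw [mem_weilZeroFinset] at hρ
    have hm : (1 : ℝ) ≤ riemannZetaZeroOrder (ρ : ℂ) := by
      exact_mod_cast ZetaZeros.riemannZetaNontrivialZeros.one_le_order ρ.2
    have hγ : (1 + (ρ : ℂ).im ^ 2) ^ 2 ≤ (1 + R ^ 2) ^ 2 := by
      have : (ρ : ℂ).im ^ 2 ≤ R ^ 2 := by
        rw [← sq_abs, ← sq_abs R]
        exact pow_le_pow_left₀ (abs_nonneg _) (hρ.trans (le_abs_self R)) 2
      gcongr
    rw [weilZeroWeight, inv_eq_one_div]
    exact div_le_div₀ (zero_le_one.trans hm) hm (by positivity) hγ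
  have hsum : ∑ ρ ∈ weilZeroFinset R, weilZeroWeight (ρ : ℂ) ≤
      ∑' ρ : ZetaZeros.riemannZetaNontrivialZeros, weilZeroWeight (ρ : ℂ) :=
    weilZeroSummable.sum_le_tsum _ fun ρ _ ↦ weilZeroWeight_nonneg ρ.2
  have hcard : ((weilZeroFinset R).card : ℝ) * ((1 + R ^ 2) ^ 2)⁻¹ ≤
      ∑ ρ ∈ weilZeroFinset R, weilZeroWeight (ρ : ℂ) := by
    rw [← nsmul_eq_mul, ← Finset.sum_const]
    exact Finset.sum_le_sum hle
  have := hcard.trans hsum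
  rwa [← div_eq_mul_inv, div_le_iff₀ hR] at this

/-! ### Good heights -/

/-- **Good heights.** In every interval `[N, N+1]` there is a height `T` whose distance to the
ordinate of every non-trivial zero is at least `η`, where `0 < η ≤ 1/2` and
`1/η ≤ 2 (M (1 + (N+3)²)² + 1)`, `M = Σ_ρ m(ρ)/(1+γ²)²` (pigeon-hole: the `K` zeros with `|Im ρ| ≤ N + 3`
exclude a set of heights of measure `≤ 2Kη < 1` for `η = 1/(2(K+1))`; Bombieri §2: "we let `T`
go to infinity along a well-chosen sequence `{T_ν}`. For this step, which is very classical, we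
refer to Ingham's excellent Cambridge Tract"). [cite: Bombieri2000Weil, §2] -/
theorem WeilExplicitFormulaProofs.exists_goodHeight (N : ℕ) :
    ∃ T : ℝ, (N : ℝ) ≤ T ∧ T ≤ N + 1 ∧ ∃ η : ℝ, 0 < η ∧ η ≤ 1 / 2 ∧
      1 / η ≤ 2 * ((∑' ρ : ZetaZeros.riemannZetaNontrivialZeros, weilZeroWeight (ρ : ℂ)) * (1 + ((N : ℝ) + 3) ^ 2) ^ 2 + 1) ∧
      ∀ ρ ∈ ZetaZeros.riemannZetaNontrivialZeros, η ≤ |ρ.im - T| := by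
  set F := weilZeroFinset ((N : ℝ) + 3) with hF
  set K : ℕ := F.card with hK
  set η : ℝ := 1 / (2 * ((K : ℝ) + 1)) with hη
  have hη0 : 0 < η := by positivity
  have hη2 : η ≤ 1 / 2 := by
    rw [hη, div_le_div_iff₀ (by positivity) two_pos]
    have : (0 : ℝ) ≤ K := Nat.cast_nonneg K
    linarith
  -- the excluded heights
  set B : Set ℝ := ⋃ ρ ∈ F, Ioo ((ρ : ℂ).im - η) ((ρ : ℂ).im + η) with hB
  have hBvol : volume B ≤ ENNReal.ofReal ((K : ℝ) * (2 * η)) := by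
    refine (measure_biUnion_finset_le F _).trans ?_
    have : ∀ ρ ∈ F, volume (Ioo ((ρ : ℂ).im - η) ((ρ : ℂ).im + η)) = ENNReal.ofReal (2 * η) := by
      intro ρ _; rw [Real.volume_Ioo]; congr 1; ring
    rw [Finset.sum_congr rfl this, Finset.sum_const, ← hK, nsmul_eq_mul,
      ENNReal.ofReal_mul (Nat.cast_nonneg K), ENNReal.ofReal_natCast]
  have hK2η : (K : ℝ) * (2 * η) < 1 := by
    rw [hη]
    have hK0 : (0 : ℝ) ≤ K := Nat.cast_nonneg K
    rw [show (K : ℝ) * (2 * (1 / (2 * ((K : ℝ) + 1)))) = K / (K + 1) by field_simp]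
    rw [div_lt_one (by positivity)]
    linarith
  have hnot : ¬ (Icc (N : ℝ) (N + 1) ⊆ B) := by
    intro hsub
    have h1 : volume (Icc (N : ℝ) (N + 1)) ≤ volume B := measure_mono hsub
    rw [Real.volume_Icc, show (N : ℝ) + 1 - N = 1 by ring, ENNReal.ofReal_one] at h1
    have := h1.trans hBvol
    rw [ENNReal.one_le_ofReal] at this
    linarith
  obtain ⟨T, hTI, hTB⟩ := Set.not_subset.1 hnot
  refine ⟨T, hTI.1, hTI.2, η, hη0, hη2, ?_, fun ρ hρ ↦ ?_⟩
  · rw [hη, one_div_one_div]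
    have := card_weilZeroFinset_le ((N : ℝ) + 3)
    rw [← hF, ← hK] at this
    linarith
  · by_contra hlt
    push Not at hlt
    have hρF : (⟨ρ, hρ⟩ : ZetaZeros.riemannZetaNontrivialZeros) ∈ F := by
      rw [hF, mem_weilZeroFinset]
      have := abs_sub_abs_le_abs_sub ρ.im T
      have hT' : |T| ≤ N + 1 := abs_le.2 ⟨by linarith [hTI.1, (Nat.cast_nonneg N : (0 : ℝ) ≤ N)], hTI.2⟩
      simp only
      linarith
    apply hTB
    rw [hB, mem_iUnion₂]
    refine ⟨⟨ρ, hρ⟩, hρF, ?_⟩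
    simp only [mem_Ioo]
    constructor <;> linarith [(abs_lt.1 hlt).1, (abs_lt.1 hlt).2]

/-- At a good height no zero has ordinate `±T`. [folklore] -/
theorem im_ne_of_good {T η : ℝ} (hη : 0 < η) (hZ : ∀ ρ ∈ ZetaZeros.riemannZetaNontrivialZeros, η ≤ |ρ.im - T|)
    {ρ : ℂ} (hρ : ρ ∈ ZetaZeros.riemannZetaNontrivialZeros) : ρ.im ≠ T ∧ ρ.im ≠ -T := by
  constructor
  · intro h
    have := hZ ρ hρ
    rw [h, sub_self, abs_zero] at this
    linarith
  · intro h
    have := hZ _ (ZetaZeros.riemannZetaNontrivialZeros.conj_mem hρ)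
    rw [conj_im, h, neg_neg, sub_self, abs_zero] at this
    linarith

/-! ### The contour identity at a good height -/

/-- **The residue theorem for `(ξ'/ξ)ĝ` on `[−1/2, 3/2] × [−T, T]`, left edge folded** (Bombieri
§2): if `T > 0` is not `±` the ordinate of a zero then
`2πi Σ_{|Im ρ| ≤ T} m(ρ) ĝ(ρ) = ∫_{−1/2}^{3/2} (ξ'/ξ ĝ)(x − iT) dx − ∫_{−1/2}^{3/2} (ξ'/ξ ĝ)(x + iT) dx
  + i ∫_{−T}^{T} (ξ'/ξ)(3/2 + iy) k̂(3/2 + iy) dy`, `k̂ = ĝ + ĝ(1 − ·)`.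
[cite: Bombieri2000Weil, §2] -/
theorem weilZeroSidePartial_eq_contour (hg : IsWeilTest g) {T : ℝ} (hT : 0 < T)
    (hgood : ∀ ρ ∈ ZetaZeros.riemannZetaNontrivialZeros, ρ.im ≠ T ∧ ρ.im ≠ -T) :
    2 * π * I * weilZeroSidePartial g T =
      (∫ x : ℝ in (-(1 / 2) : ℝ)..(3 / 2),
          logDeriv riemannXi (x + (-T : ℝ) * I) * weilMellin g (x + (-T : ℝ) * I)) -
      (∫ x : ℝ in (-(1 / 2) : ℝ)..(3 / 2),
          logDeriv riemannXi (x + T * I) * weilMellin g (x + T * I)) +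
      I * ∫ y : ℝ in (-T)..T, logDeriv riemannXi (((3 / 2 : ℝ) : ℂ) + y * I) *
          weilMellin (weilSymm g) (((3 / 2 : ℝ) : ℂ) + y * I) := by
  have hgc : Continuous g := hg.1.continuous
  -- non-vanishing of `ξ` on the four edges
  have hhor : ∀ (t : ℝ), (t = T ∨ t = -T) → ∀ x : ℝ, riemannXi (x + t * I) ≠ 0 := by
    intro t ht x h0
    have hmem := mem_riemannZetaNontrivialZeros_of_riemannXi_eq_zero h0
    have := hgood _ hmem
    simp at this
    rcases ht with rfl | rfl
    · exact this.1 rfl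
    · exact this.2 rfl
  have key := Literature.Analysis.Complex.integral_boundary_rect_logDeriv_mul (f := riemannXi) (g := weilMellin g)
    (a := -(1 / 2)) (b := 3 / 2) (c := -T) (d := T) (by norm_num) (by linarith)
    (fun z _ ↦ differentiable_riemannXi.analyticAt z) (analyticOnNhd_weilMellin hgc hg.2 _)
    (fun x _ ↦ by exact_mod_cast hhor (-T) (Or.inr rfl) x) (fun x _ ↦ hhor T (Or.inl rfl) x)
    (fun y _ ↦ riemannXi_ne_zero_of_re_le_zero (by simp))
    (fun y _ ↦ riemannXi_ne_zero_of_one_le_re (by simp; norm_num))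
  simp only [← logDeriv_apply] at key
  -- the zero sum
  have hsum : (∑ᶠ ρ ∈ {ρ : ℂ | riemannXi ρ = 0 ∧ ρ ∈ Ioo (-(1 / 2) : ℝ) (3 / 2) ×ℂ Ioo (-T) T},
      ((meromorphicOrderAt riemannXi ρ).untop₀ : ℂ) * weilMellin g ρ) = weilZeroSidePartial g T := by
    have hset : {ρ : ℂ | riemannXi ρ = 0 ∧ ρ ∈ Ioo (-(1 / 2) : ℝ) (3 / 2) ×ℂ Ioo (-T) T} =
        weilZeroIndex T := by
      ext ρ
      simp only [mem_setOf_eq, Complex.mem_reProdIm, mem_Ioo, weilZeroIndex]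
      constructor
      · rintro ⟨h0, -, hi1, hi2⟩
        obtain ⟨hζ, hre0, hre1, him⟩ := riemannXi_zero_prop h0
        exact ⟨hζ, hre0.le, hre1.le, him, abs_le.2 ⟨hi1.le, hi2.le⟩⟩
      · intro h
        have hmem : ρ ∈ ZetaZeros.riemannZetaNontrivialZeros :=
          ZetaZeros.riemannZetaNontrivialZeros.mem_of_im_ne_zero h.1 h.2.2.2.1
        have habs : |ρ.im| ≤ T := h.2.2.2.2
        obtain ⟨hne1, hne2⟩ := hgood ρ hmem
        refine ⟨riemannXi_eq_zero_of_mem_riemannZetaNontrivialZeros hmem, ⟨?_, ?_⟩, ?_, ?_⟩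
        · linarith [ZetaZeros.riemannZetaNontrivialZeros.re_pos hmem]
        · linarith [ZetaZeros.riemannZetaNontrivialZeros.re_lt_one hmem]
        · exact lt_of_le_of_ne (abs_le.1 habs).1 (Ne.symm hne2)
        · exact lt_of_le_of_ne (abs_le.1 habs).2 hne1
    rw [hset, weilZeroSidePartial]
    refine finsum_mem_congr rfl fun ρ hρ ↦ ?_
    have hmem : ρ ∈ ZetaZeros.riemannZetaNontrivialZeros := by
      rw [weilZeroIndex_eq_inter] at hρ; exact hρ.1
    rw [untop₀_meromorphicOrderAt_riemannXi (ZetaZeros.riemannZetaNontrivialZeros.re_pos hmem)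
      (ZetaZeros.riemannZetaNontrivialZeros.ne_one hmem)]
  rw [hsum] at key
  rw [← key]
  -- fold the left edge
  have hleft : (∫ y : ℝ in (-T)..T, logDeriv riemannXi (((-(1 / 2) : ℝ) : ℂ) + y * I) *
      weilMellin g (((-(1 / 2) : ℝ) : ℂ) + y * I)) =
      -∫ y : ℝ in (-T)..T, logDeriv riemannXi (((3 / 2 : ℝ) : ℂ) + y * I) *
        weilMellin g (1 - (((3 / 2 : ℝ) : ℂ) + y * I)) := by
    have e : ∀ y : ℝ, (((-(1 / 2) : ℝ) : ℂ) + y * I) = 1 - ((((3 / 2 : ℝ) : ℂ) + ((-y : ℝ) : ℂ) * I)) := by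
      intro y; push_cast; ring
    have h1 : (fun y : ℝ ↦ logDeriv riemannXi (((-(1 / 2) : ℝ) : ℂ) + y * I) *
        weilMellin g (((-(1 / 2) : ℝ) : ℂ) + y * I)) = fun y : ℝ ↦
        -((fun u : ℝ ↦ logDeriv riemannXi (((3 / 2 : ℝ) : ℂ) + u * I) *
          weilMellin g (1 - (((3 / 2 : ℝ) : ℂ) + u * I))) (-y)) := by
      funext y
      simp only
      rw [e y, logDeriv_riemannXi_one_sub]
      push_cast
      ring
    rw [h1, intervalIntegral.integral_neg, intervalIntegral.integral_comp_neg (fun u : ℝ ↦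
      logDeriv riemannXi (((3 / 2 : ℝ) : ℂ) + u * I) * weilMellin g (1 - (((3 / 2 : ℝ) : ℂ) + u * I)))]
    simp
  rw [hleft]
  -- combine the two vertical pieces into `k̂`
  have hc1 : Continuous fun y : ℝ ↦ logDeriv riemannXi (((3 / 2 : ℝ) : ℂ) + y * I) :=
    continuous_logDeriv_riemannXi_vertical (by norm_num)
  have hcg : Continuous (weilMellin g) := continuous_weilMellin hgc hg.2
  have i1 : IntervalIntegrable (fun y : ℝ ↦ logDeriv riemannXi (((3 / 2 : ℝ) : ℂ) + y * I) *
      weilMellin g (((3 / 2 : ℝ) : ℂ) + y * I)) volume (-T) T :=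
    (hc1.mul (hcg.comp (by fun_prop))).intervalIntegrable _ _
  have i2 : IntervalIntegrable (fun y : ℝ ↦ logDeriv riemannXi (((3 / 2 : ℝ) : ℂ) + y * I) *
      weilMellin g (1 - (((3 / 2 : ℝ) : ℂ) + y * I))) volume (-T) T :=
    (hc1.mul (hcg.comp (by fun_prop))).intervalIntegrable _ _
  have hk : (∫ y : ℝ in (-T)..T, logDeriv riemannXi (((3 / 2 : ℝ) : ℂ) + y * I) *
      weilMellin (weilSymm g) (((3 / 2 : ℝ) : ℂ) + y * I)) =
      (∫ y : ℝ in (-T)..T, logDeriv riemannXi (((3 / 2 : ℝ) : ℂ) + y * I) *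
        weilMellin g (((3 / 2 : ℝ) : ℂ) + y * I)) +
      ∫ y : ℝ in (-T)..T, logDeriv riemannXi (((3 / 2 : ℝ) : ℂ) + y * I) *
        weilMellin g (1 - (((3 / 2 : ℝ) : ℂ) + y * I)) := by
    rw [← intervalIntegral.integral_add i1 i2]
    congr 1 with y
    rw [weilMellin_weilSymm hg]
    ring
  rw [hk]
  push_cast
  ring

/-! ### The horizontal sides at good heights -/

/-- The horizontal sides at a good height: for `T ≥ 2`, `0 < η ≤ 1` with all non-trivial zeros
`η`-away from the ordinate `T`, and `t = ±T`,
`‖∫_{−1/2}^{3/2} (ξ'/ξ)(x + it) ĝ(x + it) dx‖ ≤ 2 · (C log(T+4)/η) · D₃/(1+T²)³`, `C` the constant of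
`exists_norm_logDeriv_riemannXi_le`, `D₃ = weilDecayW3 1 g`. [cite: Bombieri2000Weil, §2] -/
theorem norm_horizontal_le (hg : IsWeilTest g) {C : ℝ}
    (hC : ∀ (t η : ℝ), 2 ≤ |t| → 0 < η → η ≤ 1 →
      (∀ ρ : ℂ, riemannZeta ρ = 0 → 0 < ρ.re → η ≤ |ρ.im - t|) →
      ∀ σ : ℝ, σ ∈ Icc (-(1 / 2) : ℝ) (3 / 2) →
        ‖logDeriv riemannXi (σ + t * I)‖ ≤ C * Real.log (|t| + 4) / η)
    {T η : ℝ} (hT : 2 ≤ T) (hη : 0 < η) (hη1 : η ≤ 1)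
    (hZ : ∀ ρ ∈ ZetaZeros.riemannZetaNontrivialZeros, η ≤ |ρ.im - T|) {t : ℝ} (ht : t = T ∨ t = -T) :
    ‖∫ x : ℝ in (-(1 / 2) : ℝ)..(3 / 2), logDeriv riemannXi (x + t * I) * weilMellin g (x + t * I)‖ ≤
      2 * (C * Real.log (T + 4) / η) * (weilDecayW3 1 g / (1 + T ^ 2) ^ 3) := by
  have hZ' : ∀ ρ : ℂ, riemannZeta ρ = 0 → 0 < ρ.re → η ≤ |ρ.im - T| :=
    fun ρ hζ h0 ↦ hZ ρ (ZetaZeros.riemannZetaNontrivialZeros.mem_of_re_pos hζ h0)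
  have hTabs : |T| = T := abs_of_pos (by linarith)
  -- pointwise bound on the edge at height `t = ±T`
  have hpt : ∀ x ∈ Icc (-(1 / 2) : ℝ) (3 / 2),
      ‖logDeriv riemannXi (x + t * I) * weilMellin g (x + t * I)‖ ≤
        (C * Real.log (T + 4) / η) * (weilDecayW3 1 g / (1 + T ^ 2) ^ 3) := by
    intro x hx
    rw [norm_mul]
    have h1 : ‖logDeriv riemannXi (x + t * I)‖ ≤ C * Real.log (T + 4) / η := by
      rcases ht with rfl | rfl
      · have := hC t η (by rw [hTabs]; exact hT) hη hη1 hZ' x hx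
        rwa [hTabs] at this
      · have e : (x : ℂ) + ((-T : ℝ) : ℂ) * I = conj ((x : ℂ) + T * I) := by
          apply Complex.ext <;> simp
        rw [e, logDeriv_riemannXi_conj, Complex.norm_conj]
        have := hC T η (by rw [hTabs]; exact hT) hη hη1 hZ' x hx
        rwa [hTabs] at this
    have h2 : ‖weilMellin g (x + t * I)‖ ≤ weilDecayW3 1 g / (1 + T ^ 2) ^ 3 := by
      have := norm_weilMellin_le_cube hg (A := 1) (s := x + t * I)
        (by simp; exact abs_le.2 ⟨by linarith [hx.1], by linarith [hx.2]⟩)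
      have ht2 : t ^ 2 = T ^ 2 := by rcases ht with rfl | rfl <;> ring
      simpa [ht2] using this
    have h0 : 0 ≤ C * Real.log (T + 4) / η := by
      refine le_trans (norm_nonneg _) (h1)
    exact mul_le_mul h1 h2 (norm_nonneg _) h0
  have h := intervalIntegral.norm_integral_le_of_norm_le_const (a := (-(1 / 2) : ℝ)) (b := 3 / 2)
    (f := fun x : ℝ ↦ logDeriv riemannXi (x + t * I) * weilMellin g (x + t * I))
    (C := (C * Real.log (T + 4) / η) * (weilDecayW3 1 g / (1 + T ^ 2) ^ 3)) fun x hx ↦ by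
      rw [uIoc_of_le (by norm_num)] at hx
      exact hpt x ⟨hx.1.le, hx.2⟩
  refine h.trans (le_of_eq ?_)
  rw [show |(3 : ℝ) / 2 - -(1 / 2)| = 2 by norm_num]
  ring

/-- Bookkeeping for the horizontal sides: with `N ≤ T ≤ N + 1`, `N ≥ 1` and
`1/η ≤ 2(S(1+(N+3)²)² + 1)`, the bound `2 (C log(T+4)/η) W/(1+T²)³` is at most
`24 C (289 S + 1) W / N`. [folklore] -/
theorem horizontal_bound_aux {C S W : ℝ} (hC : 0 ≤ C) (hS : 0 ≤ S) (hW : 0 ≤ W) {N : ℕ}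
    (hN : 1 ≤ N) {T η : ℝ} (hT1 : (N : ℝ) ≤ T) (hT2 : T ≤ N + 1) (hη : 0 < η)
    (hη' : 1 / η ≤ 2 * (S * (1 + ((N : ℝ) + 3) ^ 2) ^ 2 + 1)) :
    2 * (C * Real.log (T + 4) / η) * (W / (1 + T ^ 2) ^ 3) ≤ 24 * C * (289 * S + 1) * W / N := by
  have hN' : (1 : ℝ) ≤ N := by exact_mod_cast hN
  have hT0 : 1 ≤ T := hN'.trans hT1
  have hlog : Real.log (T + 4) ≤ 6 * N := by
    have := Real.log_le_sub_one_of_pos (by linarith : 0 < T + 4)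
    linarith
  have hpoly : (1 + ((N : ℝ) + 3) ^ 2) ^ 2 ≤ 289 * (N : ℝ) ^ 4 := by
    have h1 : 1 + ((N : ℝ) + 3) ^ 2 ≤ 17 * (N : ℝ) ^ 2 := by nlinarith
    calc (1 + ((N : ℝ) + 3) ^ 2) ^ 2 ≤ (17 * (N : ℝ) ^ 2) ^ 2 := by gcongr
      _ = 289 * (N : ℝ) ^ 4 := by ring
  have hN4 : (1 : ℝ) ≤ (N : ℝ) ^ 4 := one_le_pow₀ hN'
  have hinv : 1 / η ≤ 2 * (289 * S + 1) * (N : ℝ) ^ 4 := by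
    calc 1 / η ≤ 2 * (S * (1 + ((N : ℝ) + 3) ^ 2) ^ 2 + 1) := hη'
      _ ≤ 2 * (S * (289 * (N : ℝ) ^ 4) + (N : ℝ) ^ 4) := by gcongr
      _ = 2 * (289 * S + 1) * (N : ℝ) ^ 4 := by ring
  have hden : W / (1 + T ^ 2) ^ 3 ≤ W / (N : ℝ) ^ 6 := by
    refine div_le_div_of_nonneg_left hW (by positivity) ?_
    calc (N : ℝ) ^ 6 = ((N : ℝ) ^ 2) ^ 3 := by ring
      _ ≤ (1 + T ^ 2) ^ 3 := by gcongr; nlinarith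
  have hlog0 : 0 ≤ Real.log (T + 4) := Real.log_nonneg (by linarith)
  calc 2 * (C * Real.log (T + 4) / η) * (W / (1 + T ^ 2) ^ 3)
      = 2 * (C * Real.log (T + 4) * (1 / η)) * (W / (1 + T ^ 2) ^ 3) := by rw [mul_one_div]
    _ ≤ 2 * (C * (6 * N) * (2 * (289 * S + 1) * (N : ℝ) ^ 4)) * (W / (N : ℝ) ^ 6) := by
        gcongr
    _ = 24 * C * (289 * S + 1) * W / N := by
        field_simp
        ring

/-! ### Assembly -/

/-- Summability of the zero side for a test function: `Σ_ρ ‖m(ρ) ĝ(ρ)‖ < ∞`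
(`|ĝ(ρ)| ≤ D/(1+γ²)²` in the strip and `weilZeroSummable`). [folklore] -/
theorem summable_norm_zeroSide (hg : IsWeilTest g) :
    Summable fun ρ : ZetaZeros.riemannZetaNontrivialZeros ↦
      ‖(riemannZetaZeroOrder (ρ : ℂ) : ℂ) * weilMellin g ρ‖ :=
  summable_norm_zeroSide_of_le (K := weilDecayW2 (1 / 2) g) fun ρ hρ ↦
    norm_weilMellin_le_sq hg (abs_le.2 ⟨by linarith [ZetaZeros.riemannZetaNontrivialZeros.re_pos hρ],
      by linarith [ZetaZeros.riemannZetaNontrivialZeros.re_lt_one hρ]⟩)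

/-- **DISCHARGE of `Literature.NumberTheory.LFunctions.explicit_formula`: the Guinand–Weil explicit formula for `ζ`**
(Weil 1952; Bombieri 2000, §2 and Theorem 2, transported by `x = e^t`; Iwaniec–Kowalski
Thm. 5.12): for every smooth compactly supported `g`,
`lim_{T→∞} Σ_{|Im ρ| ≤ T} m(ρ) ĝ(ρ) = weilFunctional g`. [cite: Bombieri2000Weil, §2 Thm. 2] -/
theorem explicit_formula_holds : explicit_formula := by
  intro g hg
  -- the zero side converges absolutely, to `Z`
  set Z : ℂ := ∑' ρ : ZetaZeros.riemannZetaNontrivialZeros, (riemannZetaZeroOrder (ρ : ℂ) : ℂ) * weilMellin g ρ with hZdef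
  have hZ : HasWeilZeroSide g Z := hasWeilZeroSide_tsum (summable_norm_zeroSide hg)
  suffices hZW : Z = weilFunctional g by rwa [hZW] at hZ
  -- good heights
  choose T hT1 hT2 η hη0 hη2 hηinv hηZ using WeilExplicitFormulaProofs.exists_goodHeight
  have hTtop : Tendsto T atTop atTop :=
    tendsto_atTop_mono hT1 tendsto_natCast_atTop_atTop
  -- the pieces of the contour
  set bot : ℕ → ℂ := fun N ↦ ∫ x : ℝ in (-(1 / 2) : ℝ)..(3 / 2),
    logDeriv riemannXi (x + (-T N : ℝ) * I) * weilMellin g (x + (-T N : ℝ) * I) with hbot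
  set top : ℕ → ℂ := fun N ↦ ∫ x : ℝ in (-(1 / 2) : ℝ)..(3 / 2),
    logDeriv riemannXi (x + T N * I) * weilMellin g (x + T N * I) with htop
  set V : ℕ → ℂ := fun N ↦ ∫ y : ℝ in (-T N)..T N, logDeriv riemannXi (((3 / 2 : ℝ) : ℂ) + y * I) *
    weilMellin (weilSymm g) (((3 / 2 : ℝ) : ℂ) + y * I) with hV
  set Vinf : ℂ := ∫ y : ℝ, logDeriv riemannXi (((3 / 2 : ℝ) : ℂ) + y * I) *
    weilMellin (weilSymm g) (((3 / 2 : ℝ) : ℂ) + y * I) with hVinf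
  have hVinf : Vinf = 2 * π * weilFunctional g := integral_logDeriv_riemannXi_mul_weilMellin_weilSymm hg
  -- the contour identity along the good heights
  have hident : ∀ N : ℕ, 2 ≤ N →
      weilZeroSidePartial g (T N) = (bot N - top N + I * V N) / (2 * π * I) := by
    intro N hN
    have hN' : (2 : ℝ) ≤ N := by exact_mod_cast hN
    have hTpos : 0 < T N := by linarith [hT1 N]
    have h := weilZeroSidePartial_eq_contour hg hTpos fun ρ hρ ↦ im_ne_of_good (hη0 N) (hηZ N) hρ
    have h2πI : (2 * π * I : ℂ) ≠ 0 := by simp [Real.pi_ne_zero, I_ne_zero]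
    rw [eq_div_iff h2πI, mul_comm, h]
  -- limits of the pieces
  obtain ⟨C, hC0, hC⟩ := exists_norm_logDeriv_riemannXi_le
  have hedge : ∀ e : ℝ, (e = 1 ∨ e = -1) → Tendsto (fun N : ℕ ↦ ∫ x : ℝ in (-(1 / 2) : ℝ)..(3 / 2),
      logDeriv riemannXi (x + (e * T N : ℝ) * I) * weilMellin g (x + (e * T N : ℝ) * I)) atTop (𝓝 0) := by
    intro e he
    rw [tendsto_zero_iff_norm_tendsto_zero]
    have hM := tendsto_const_div_atTop_nhds_zero_nat
      (24 * C * (289 * (∑' ρ : ZetaZeros.riemannZetaNontrivialZeros, weilZeroWeight (ρ : ℂ)) + 1) * weilDecayW3 1 g)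
    refine squeeze_zero' (Eventually.of_forall fun _ ↦ norm_nonneg _)
      ((eventually_ge_atTop 2).mono fun N hN ↦ ?_) hM
    have hN' : (2 : ℝ) ≤ N := by exact_mod_cast hN
    have hTN : 2 ≤ T N := by linarith [hT1 N]
    have het : e * T N = T N ∨ e * T N = -T N := by
      rcases he with rfl | rfl
      · exact Or.inl (one_mul _)
      · exact Or.inr (neg_one_mul _)
    refine (norm_horizontal_le hg hC hTN (hη0 N) ((hη2 N).trans (by norm_num)) (hηZ N) het).trans ?_
    exact horizontal_bound_aux hC0.le tsum_weilZeroWeight_nonneg (weilDecayW3_nonneg _ _)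
      (le_trans (by norm_num) hN) (hT1 N) (hT2 N) (hη0 N) (hηinv N)
  have hbot_lim : Tendsto bot atTop (𝓝 0) := by
    refine (hedge (-1) (Or.inr rfl)).congr fun N ↦ ?_
    simp [hbot]
  have htop_lim : Tendsto top atTop (𝓝 0) := by
    refine (hedge 1 (Or.inl rfl)).congr fun N ↦ ?_
    simp [htop]
  have hV_lim : Tendsto V atTop (𝓝 Vinf) := by
    have hint := integrable_logDeriv_riemannXi_mul_weilMellin hg.weilSymm
    exact intervalIntegral_tendsto_integral hint (tendsto_neg_atTop_atBot.comp hTtop) hTtop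
  have hrhs : Tendsto (fun N ↦ (bot N - top N + I * V N) / (2 * π * I)) atTop
      (𝓝 ((0 - 0 + I * Vinf) / (2 * π * I))) :=
    ((hbot_lim.sub htop_lim).add (hV_lim.const_mul I)).div_const _
  -- the zero side along the good heights
  have hS : Tendsto (fun N ↦ weilZeroSidePartial g (T N)) atTop (𝓝 Z) := hZ.comp hTtop
  have hS' : Tendsto (fun N ↦ weilZeroSidePartial g (T N)) atTop (𝓝 ((0 - 0 + I * Vinf) / (2 * π * I))) :=
    hrhs.congr' ((eventually_ge_atTop 2).mono fun N hN ↦ (hident N hN).symm)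
  have hlim := tendsto_nhds_unique hS hS'
  rw [hlim, hVinf]
  have h2πI : (2 * π * I : ℂ) ≠ 0 := by simp [Real.pi_ne_zero, I_ne_zero]
  field_simp
  ring

end Literature.NumberTheory.LFunctions

end
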